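import Summits.AtomisticToContinuum.Crystallization.Theorems.OverbindingBudgetAffineLatticeLines
import Summits.AtomisticToContinuum.Crystallization.Theorems.OverbindingBudgetAffineLayerSpread

/-!
# Overbinding budget, affine far-core cell (31280 Z2): THE PLANAR LAYER `k = 0` as an explicit sum of lattice lines
# (decomp-a2c lens-4, generation 66, Deliverable H part 2 of 2 = memo NODE-g66 §12, item (T1) planar layer)

Imports g66 H1 `…LatticeLines` (`tsum_int_line_eq`, `inner_sq_lt_of_not_mem_span`, `besselKReal_half_add_eq`) and tree `…LayerSpread`
(`map_layerVec`, `layerShift`, `linearIndependent_map_pair`; transitively tree `…FarCoreWindowsA`: `layerTerm`, `layerSum`, and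
`…LayerPoisson`: `finrank_span_pair`), Mathlib `ZLattice.summable_norm_pow_inv`, `hasSum_zeta_nat`.  Restates nothing.
PROVED, 0 sorry, standard axioms (probe `TowerTreeG66H.lean`; pins `TowerTreeG66HPins.lean`; must-fail `TowerTreeG66HMustFail.lean`).

* §H4 `summable_int_pair_norm_inv_pow` — `Σ_{(i,j)∈ℤ²} ‖iu + jv‖⁻ⁿ` is summable for independent `u, v`, `n ≥ 3` (Mathlib's
  `ZLattice.summable_norm_pow_inv` transported along `ℤ² ≃ ℤb₀ + ℤb₁`); `tsum_int_pair_eq_tsum_lines` (Tonelli over `j`);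
  `hasSum_int_inv_sq_pow` / `tsum_int_smul_line_zero` (the `j = 0` line `= 2ζ(2σ)/‖u‖^{2σ}`); `bernoulli'_six` (`B₆ = 1/42`),
  ★ `hasSum_zeta_six` (`ζ(6) = π⁶/945`); `layerTerm_zero_zero_eq` (`layerTerm B (2σ) 0 0 (i,j) = ‖iBt₁ + jBt₂‖^{−2σ}`);
  ★★ `layerSum_zero_zero_eq_lines` — for injective `B`, `σ ≥ 2`: `Summable (layerTerm B (2σ) 0 0)` and
  `layerSum B (2σ) 0 0 = Σ_{j∈ℤ} Σ_{i∈ℤ} ‖iBt₁ + jBt₂‖^{−2σ}`; `inner_sq_lt_line` (the lines `j ≠ 0` are off `ℝ·Bt₁`).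
* §H5 `planarLine σ g₀₀ g₀₁ D S j` (the `j`-th line in GRAM variables), ★★ `layerSum_zero_zero_eq_planarLines` —
  `layerSum B (2σ) 0 0 = Σ_{j∈ℤ} planarLine σ ‖Bt₁‖² ⟪Bt₁,Bt₂⟫ (‖Bt₁‖²‖Bt₂‖² − ⟪Bt₁,Bt₂⟫²) S j` for any `S` with
  `HasSum (n ↦ n^{−2σ}) S`; `besselKReal_sub_half_eq_halfPoly` (the Bessel factor is elementary); `windowLabel_zero` (the window's own layer has label `0`:
  G2's `k = 0` near term is literally `layerSum B n 0 0`), `layerTerm_zero_zero_origin` (the origin term is `0⁻¹ = 0`).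
  For the TABLE: `T₃↑` needs only an UPPER bound of `layerSum B 6 0 0` and `T₆↓` only a LOWER bound of `layerSum B 12 0 0`
  (memo §12: truncate the `(j, m)` double series — terms decay like `e^{−2π|jm|√D/g₀₀}`, `≈ e^{−5.44|jm|}` at hcp — and
  bound / drop the tails one-sidedly).
-/

noncomputable section

open MeasureTheory Set Module
open scoped Real InnerProductSpace

namespace Summit.AtomisticToContinuum.Crystallization.Theorems.OverbindingBudgetAffineFarSmoothSplit
open Literature.MathematicalPhysics.StatisticalMechanics Literature.Algebra.EuclideanLattices
  Literature.Analysis.FunctionSpaces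
local notation "E3" => EuclideanSpace ℝ (Fin 3)

/-! ## §H4 The planar layer `k = 0`: summability, line decomposition, the `j = 0` line (`ζ(2σ)`), `ζ(6) = π⁶/945` -/

section PlanarGeneric

variable {E : Type*} [NormedAddCommGroup E] [InnerProductSpace ℝ E] [FiniteDimensional ℝ E]

/-- **Summability of a planar lattice sum** `Σ_{(i,j)∈ℤ²} ‖iu + jv‖⁻ⁿ` (`n ≥ 3`, `u, v` independent; the origin term is
`0⁻¹ⁿ = 0`), transported from Mathlib's `ZLattice.summable_norm_pow_inv`. [folklore] -/
theorem summable_int_pair_norm_inv_pow {u v : E} (huv : LinearIndependent ℝ ![u, v]) (n : ℕ) (hn : 2 < n) :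
    Summable fun ij : ℤ × ℤ => ‖(ij.1 : ℝ) • u + (ij.2 : ℝ) • v‖⁻¹ ^ n := by
  set b := Basis.span huv with hb
  set Λ : Submodule ℤ (Submodule.span ℝ (Set.range ![u, v])) := Submodule.span ℤ (Set.range b) with hΛ
  have hrank : Module.finrank ℤ Λ < n := by
    rw [ZLattice.rank ℝ Λ, finrank_span_pair huv]; exact hn
  have hs := ZLattice.summable_norm_pow_inv Λ n hrank
  have hmem : ∀ ij : ℤ × ℤ, ij.1 • b 0 + ij.2 • b 1 ∈ Λ := fun ij =>
    add_mem (Submodule.smul_mem _ _ (Submodule.subset_span ⟨0, rfl⟩))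
      (Submodule.smul_mem _ _ (Submodule.subset_span ⟨1, rfl⟩))
  let φ : ℤ × ℤ → Λ := fun ij => ⟨ij.1 • b 0 + ij.2 • b 1, hmem ij⟩
  have hφ : Function.Bijective φ := by
    constructor
    · intro ij ij' h
      have h1 : ij.1 • b 0 + ij.2 • b 1 = ij'.1 • b 0 + ij'.2 • b 1 := congrArg Subtype.val h
      have h2 : ((ij.1 - ij'.1 : ℤ) : ℝ) • b 0 + ((ij.2 - ij'.2 : ℤ) : ℝ) • b 1 = 0 := by
        rw [Int.cast_smul_eq_zsmul, Int.cast_smul_eq_zsmul, sub_smul, sub_smul]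
        rw [← sub_eq_zero] at h1
        rw [← h1]; abel
      have hli := Fintype.linearIndependent_iff.1 b.linearIndependent
        ![((ij.1 - ij'.1 : ℤ) : ℝ), ((ij.2 - ij'.2 : ℤ) : ℝ)] (by simpa [Fin.sum_univ_two] using h2)
      have e0 := hli 0
      have e1 := hli 1
      simp only [Matrix.cons_val_zero, Matrix.cons_val_one, Int.cast_eq_zero,
        sub_eq_zero] at e0 e1
      exact Prod.ext e0 e1
    · intro y
      obtain ⟨c, hc⟩ := (Submodule.mem_span_range_iff_exists_fun ℤ).1 y.2
      refine ⟨(c 0, c 1), Subtype.ext ?_⟩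
      simp only [φ]
      rw [← hc, Fin.sum_univ_two]
  have h := (Equiv.ofBijective φ hφ).summable_iff.2 hs
  refine h.congr fun ij => ?_
  simp only [Function.comp_apply, Equiv.ofBijective_apply, φ, Submodule.coe_norm,
    Submodule.coe_add, Submodule.coe_smul_of_tower, ← Int.cast_smul_eq_zsmul ℝ, hb, Basis.span_apply,
    Matrix.cons_val_zero, Matrix.cons_val_one]

/-- **Line decomposition of a planar lattice sum** (Tonelli over `j`): for `u, v` independent and `σ ≥ 2`,
`Σ_{(i,j)∈ℤ²} ‖iu + jv‖^{−2σ} = Σ_{j∈ℤ} Σ_{i∈ℤ} ‖iu + jv‖^{−2σ}`. [folklore] -/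
theorem tsum_int_pair_eq_tsum_lines {u v : E} (huv : LinearIndependent ℝ ![u, v]) (σ : ℕ) (hσ : 2 ≤ σ) :
    ∑' ij : ℤ × ℤ, ((‖(ij.1 : ℝ) • u + (ij.2 : ℝ) • v‖ ^ 2) ^ σ)⁻¹ =
      ∑' j : ℤ, ∑' i : ℤ, ((‖(i : ℝ) • u + (j : ℝ) • v‖ ^ 2) ^ σ)⁻¹ := by
  have hs := summable_int_pair_norm_inv_pow huv (2 * σ) (by omega)
  have hs' : Summable fun ij : ℤ × ℤ => ((‖(ij.1 : ℝ) • u + (ij.2 : ℝ) • v‖ ^ 2) ^ σ)⁻¹ := by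
    refine hs.congr fun ij => ?_
    rw [← pow_mul, inv_pow]
  -- swap the coordinates so that the outer sum runs over `j`
  have hswap : ∑' ij : ℤ × ℤ, ((‖(ij.1 : ℝ) • u + (ij.2 : ℝ) • v‖ ^ 2) ^ σ)⁻¹ =
      ∑' ji : ℤ × ℤ, ((‖(ji.2 : ℝ) • u + (ji.1 : ℝ) • v‖ ^ 2) ^ σ)⁻¹ := by
    rw [← (Equiv.prodComm ℤ ℤ).tsum_eq]; rfl
  have hs'' : Summable fun ji : ℤ × ℤ => ((‖(ji.2 : ℝ) • u + (ji.1 : ℝ) • v‖ ^ 2) ^ σ)⁻¹ :=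
    (Equiv.prodComm ℤ ℤ).summable_iff.2 hs'
  rw [hswap, hs''.tsum_prod' fun j => ?_]
  exact hs''.prod_factor j

/-- **The `j = 0` line**: `Σ_{i∈ℤ} ‖iu‖^{−2σ} = 2 (‖u‖²)^{−σ} Σ_{n∈ℕ} n^{−2σ}` (`= 2 ζ(2σ)/‖u‖^{2σ}`; the `i = 0` term is `0`). -/
theorem hasSum_int_inv_sq_pow (σ : ℕ) (hσ : 1 ≤ σ) {S : ℝ}
    (hS : HasSum (fun n : ℕ => 1 / (n : ℝ) ^ (2 * σ)) S) :
    HasSum (fun i : ℤ => (((i : ℝ) ^ 2) ^ σ)⁻¹) (2 * S) := by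
  have e1 : ∀ n : ℕ, ((((n : ℤ) : ℝ) ^ 2) ^ σ)⁻¹ = 1 / (n : ℝ) ^ (2 * σ) := by
    intro n; rw [Int.cast_natCast, ← pow_mul, one_div]
  have h1 : HasSum (fun n : ℕ => ((((n : ℤ) : ℝ) ^ 2) ^ σ)⁻¹) S := by simp_rw [e1]; exact hS
  have e2 : ∀ n : ℕ, ((((-((n : ℤ) + 1) : ℤ) : ℝ) ^ 2) ^ σ)⁻¹ = 1 / (((n + 1 : ℕ)) : ℝ) ^ (2 * σ) := by
    intro n; push_cast; rw [neg_sq, ← pow_mul, one_div]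
  have h2 : HasSum (fun n : ℕ => ((((-((n : ℤ) + 1) : ℤ) : ℝ) ^ 2) ^ σ)⁻¹) S := by
    simp_rw [e2]
    have h := (hasSum_nat_add_iff' (f := fun n : ℕ => 1 / (n : ℝ) ^ (2 * σ)) 1 (g := S)).2 hS
    have h0 : (1 : ℝ) / ((0 : ℕ) : ℝ) ^ (2 * σ) = 0 := by
      rw [Nat.cast_zero, zero_pow (by omega), div_zero]
    rw [Finset.sum_range_one, h0, sub_zero] at h
    exact h
  have h := HasSum.of_nat_of_neg_add_one (f := fun i : ℤ => (((i : ℝ) ^ 2) ^ σ)⁻¹) h1 h2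
  rwa [← two_mul] at h

omit [FiniteDimensional ℝ E] in
/-- `tsum_int_smul_line_zero` (docstring added by the landing lane; see the module docstring). [formal bookkeeping] -/
theorem tsum_int_smul_line_zero (σ : ℕ) (hσ : 1 ≤ σ) (u : E) {S : ℝ}
    (hS : HasSum (fun n : ℕ => 1 / (n : ℝ) ^ (2 * σ)) S) :
    ∑' i : ℤ, ((‖(i : ℝ) • u + ((0 : ℤ) : ℝ) • u‖ ^ 2) ^ σ)⁻¹ = ((‖u‖ ^ 2) ^ σ)⁻¹ * (2 * S) := by
  have e : ∀ i : ℤ, ((‖(i : ℝ) • u + ((0 : ℤ) : ℝ) • u‖ ^ 2) ^ σ)⁻¹ = ((‖u‖ ^ 2) ^ σ)⁻¹ * (((i : ℝ) ^ 2) ^ σ)⁻¹ := by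
    intro i
    rw [Int.cast_zero, zero_smul, add_zero, norm_smul, Real.norm_eq_abs, mul_pow, sq_abs, mul_pow, mul_inv, mul_comm]
  simp_rw [e]
  rw [tsum_mul_left, (hasSum_int_inv_sq_pow σ hσ hS).tsum_eq]

/-- `B₆' = 1/42`. [cite: DLMF, 24.2.1] (dedup gate: public twin PeriodPair.bernoulli'_six lives in an unrelated Literature module (EllipticCurves); kept PRIVATE here) -/
private theorem bernoulli'_six : bernoulli' 6 = 1 / 42 := by
  have c2 : Nat.choose 6 2 = 15 := by decide
  have c3 : Nat.choose 6 3 = 20 := by decide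
  have c4 : Nat.choose 6 4 = 15 := by decide
  have c5 : Nat.choose 6 5 = 6 := by decide
  have h5 : bernoulli' 5 = 0 := bernoulli'_eq_zero_of_odd (by decide) (by norm_num)
  rw [bernoulli'_def]
  norm_num [Finset.sum_range_succ, Finset.sum_range_zero, c2, c3, c4, c5, h5, bernoulli'_three, bernoulli'_four]

/-- **`ζ(6) = π⁶/945`**. [cite: DLMF, 25.6.1] -/
theorem hasSum_zeta_six : HasSum (fun n : ℕ => (1 : ℝ) / (n : ℝ) ^ 6) (π ^ 6 / 945) := by
  convert! hasSum_zeta_nat (k := 3) (by norm_num) using 1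
  simp only [Nat.reduceAdd, Nat.reduceMul, Nat.add_one_sub_one]
  rw [bernoulli_eq_bernoulli'_of_ne_one, bernoulli'_six]
  · simp [Nat.factorial]; ring
  · decide

end PlanarGeneric

section PlanarLayer

/-- **The planar layer `k = 0` (label `0`) is the planar lattice sum of `B t₁, B t₂`**:
`layerTerm B (2σ) 0 0 (i,j) = ‖i Bt₁ + j Bt₂‖^{−2σ}`. [this file] -/
theorem layerTerm_zero_zero_eq (B : E3 →ₗ[ℝ] E3) (σ : ℕ) (ij : ℤ × ℤ) :
    layerTerm B (2 * σ) 0 0 ij =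
      ((‖(ij.1 : ℝ) • B (triangularVec₁ 1) + (ij.2 : ℝ) • B (triangularVec₂ 1)‖ ^ 2) ^ σ)⁻¹ := by
  unfold layerTerm
  rw [map_layerVec, show layerShift B 0 0 = 0 by simp [layerShift], add_zero, pow_mul, inv_pow, inv_pow]

/-- ★★ **Line decomposition of the planar layer**: for injective `B` and `σ ≥ 2`,
`layerSum B (2σ) 0 0 = Σ_{j∈ℤ} Σ_{i∈ℤ} ‖i Bt₁ + j Bt₂‖^{−2σ}`; the `j = 0` line is `2ζ(2σ)/‖Bt₁‖^{2σ}`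
(`tsum_int_smul_line_zero`, `hasSum_zeta_six`), every `j ≠ 0` line is EXPLICIT by `tsum_int_line_eq` with
`u = Bt₁`, `p = j·Bt₂` (off-line by `inner_sq_lt_of_not_mem_span`). [this file] -/
theorem layerSum_zero_zero_eq_lines (B : E3 →ₗ[ℝ] E3) (hB : Function.Injective B) (σ : ℕ) (hσ : 2 ≤ σ) :
    Summable (layerTerm B (2 * σ) 0 0) ∧
    layerSum B (2 * σ) 0 0 =
      ∑' j : ℤ, ∑' i : ℤ, ((‖(i : ℝ) • B (triangularVec₁ 1) + (j : ℝ) • B (triangularVec₂ 1)‖ ^ 2) ^ σ)⁻¹ := by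
  have huv := linearIndependent_map_pair B hB
  refine ⟨?_, ?_⟩
  · have hs := summable_int_pair_norm_inv_pow huv (2 * σ) (by omega)
    refine hs.congr fun ij => ?_
    rw [layerTerm_zero_zero_eq, ← pow_mul, inv_pow]
  · unfold layerSum
    rw [tsum_congr (layerTerm_zero_zero_eq B σ), tsum_int_pair_eq_tsum_lines huv σ hσ]

/-- The `j ≠ 0` lines are off the line `ℝ·Bt₁` (so `tsum_int_line_eq` applies with `p = j·Bt₂`). [this file] -/
theorem inner_sq_lt_line (B : E3 →ₗ[ℝ] E3) (hB : Function.Injective B) {j : ℤ} (hj : j ≠ 0) :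
    ⟪(j : ℝ) • B (triangularVec₂ 1), B (triangularVec₁ 1)⟫_ℝ ^ 2 <
      ‖(j : ℝ) • B (triangularVec₂ 1)‖ ^ 2 * ‖B (triangularVec₁ 1)‖ ^ 2 := by
  have huv := linearIndependent_map_pair B hB
  have hu : B (triangularVec₁ 1) ≠ 0 := by
    have := huv.ne_zero 0; simpa using this
  refine inner_sq_lt_of_not_mem_span hu fun hmem => ?_
  rw [Submodule.mem_span_singleton] at hmem
  obtain ⟨r, hr⟩ := hmem
  -- `r • u = j • v` contradicts independence
  have h0 : r • B (triangularVec₁ 1) + (-(j : ℝ)) • B (triangularVec₂ 1) = 0 := by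
    rw [hr, neg_smul, add_neg_cancel]
  have hli := Fintype.linearIndependent_iff.1 huv ![r, -(j : ℝ)] (by simpa [Fin.sum_univ_two] using h0)
  have := hli 1
  simp only [Matrix.cons_val_one, Matrix.cons_val_zero, neg_eq_zero, Int.cast_eq_zero] at this
  exact hj this

end PlanarLayer

/-! ## §H5 The planar layer in Gram variables: `layerSum B (2σ) 0 0 = Σ_j planarLine σ g₀₀ g₀₁ D S j` -/

section PlanarExplicit

/-- The `j`-th LINE of the planar layer in Gram variables `g₀₀ = ‖Bt₁‖²`, `g₀₁ = ⟪Bt₁,Bt₂⟫`, `D = det Gram(Bt₁,Bt₂)`,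
`S = ζ(2σ)`: `j = 0`: `2S/g₀₀^σ`; `j ≠ 0` (`c = j²D/g₀₀²`):
`g₀₀^{−σ} (√π/Γσ) (Γ(σ−½)/c^{σ−½} + 2 Σ_{m∈ℤ} cos(2π (j g₀₁/g₀₀) m) (π|m|/√c)^{σ−½} K_{σ−½}(2π√c|m|))`. -/
def planarLine (σ : ℕ) (g₀₀ g₀₁ D S : ℝ) (j : ℤ) : ℝ :=
  if j = 0 then (g₀₀ ^ σ)⁻¹ * (2 * S)
  else (g₀₀ ^ σ)⁻¹ * (Real.sqrt π / Real.Gamma σ *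
    (Real.Gamma ((σ : ℝ) - 1 / 2) / ((j : ℝ) ^ 2 * D / g₀₀ ^ 2) ^ ((σ : ℝ) - 1 / 2) +
      2 * ∑' m : ℤ, Real.cos (2 * π * ((j : ℝ) * g₀₁ / g₀₀) * m) *
        ((π * |(m : ℝ)| / Real.sqrt ((j : ℝ) ^ 2 * D / g₀₀ ^ 2)) ^ ((σ : ℝ) - 1 / 2) *
          besselKReal ((σ : ℝ) - 1 / 2) (2 * π * Real.sqrt ((j : ℝ) ^ 2 * D / g₀₀ ^ 2) * |(m : ℝ)|))))

/-- ★★ **The planar layer, explicit** (injective `B`, `σ ≥ 2`, `S = Σ_n n^{−2σ} = ζ(2σ)`): with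
`g₀₀ = ‖Bt₁‖²`, `g₀₁ = ⟪Bt₁, Bt₂⟫`, `D = ‖Bt₁‖²‖Bt₂‖² − ⟪Bt₁,Bt₂⟫²`,
`layerSum B (2σ) 0 0 = Σ_{j∈ℤ} planarLine σ g₀₀ g₀₁ D S j` — every line an ELEMENTARY series
(`besselKReal_half_add_eq`: `K_{σ−½}(y) = √(π/(2y)) e^{−y} halfPoly (σ−1) y`), geometrically convergent in `(j, m)`
(`e^{−2π|jm|√D/g₀₀}`); `ζ(6) = π⁶/945` (`hasSum_zeta_six`). The `k = 0` entry of both window sums. [this file] -/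
theorem layerSum_zero_zero_eq_planarLines (B : E3 →ₗ[ℝ] E3) (hB : Function.Injective B) (σ : ℕ) (hσ : 2 ≤ σ)
    {S : ℝ} (hS : HasSum (fun n : ℕ => 1 / (n : ℝ) ^ (2 * σ)) S) :
    layerSum B (2 * σ) 0 0 =
      ∑' j : ℤ, planarLine σ (‖B (triangularVec₁ 1)‖ ^ 2) ⟪B (triangularVec₁ 1), B (triangularVec₂ 1)⟫_ℝ
        (‖B (triangularVec₁ 1)‖ ^ 2 * ‖B (triangularVec₂ 1)‖ ^ 2 - ⟪B (triangularVec₁ 1), B (triangularVec₂ 1)⟫_ℝ ^ 2)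
        S j := by
  rw [(layerSum_zero_zero_eq_lines B hB σ hσ).2]
  refine tsum_congr fun j => ?_
  have huv := linearIndependent_map_pair B hB
  have hu : B (triangularVec₁ 1) ≠ 0 := by
    have := huv.ne_zero 0; simpa using this
  unfold planarLine
  split_ifs with hj
  · -- the `j = 0` line
    rw [hj, ← tsum_int_smul_line_zero σ (by omega) (B (triangularVec₁ 1)) hS]
    refine tsum_congr fun i => ?_
    simp
  · -- a `j ≠ 0` line: `tsum_int_line_eq` with `u = Bt₁`, `p = j • Bt₂`
    rw [tsum_int_line_eq σ (by omega) hu (inner_sq_lt_line B hB hj)]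
    have ha : ‖B (triangularVec₁ 1)‖ ^ 2 ≠ 0 := by positivity
    have e1 : ⟪(j : ℝ) • B (triangularVec₂ 1), B (triangularVec₁ 1)⟫_ℝ =
        (j : ℝ) * ⟪B (triangularVec₁ 1), B (triangularVec₂ 1)⟫_ℝ := by
      rw [real_inner_smul_left, real_inner_comm]
    have e2 : ‖(j : ℝ) • B (triangularVec₂ 1)‖ ^ 2 = (j : ℝ) ^ 2 * ‖B (triangularVec₂ 1)‖ ^ 2 := by
      rw [norm_smul, mul_pow, Real.norm_eq_abs, sq_abs]
    have e3 : (‖(j : ℝ) • B (triangularVec₂ 1)‖ ^ 2 * ‖B (triangularVec₁ 1)‖ ^ 2 -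
          ⟪(j : ℝ) • B (triangularVec₂ 1), B (triangularVec₁ 1)⟫_ℝ ^ 2) / (‖B (triangularVec₁ 1)‖ ^ 2) ^ 2 =
        (j : ℝ) ^ 2 * (‖B (triangularVec₁ 1)‖ ^ 2 * ‖B (triangularVec₂ 1)‖ ^ 2 -
          ⟪B (triangularVec₁ 1), B (triangularVec₂ 1)⟫_ℝ ^ 2) / (‖B (triangularVec₁ 1)‖ ^ 2) ^ 2 := by
      rw [e1, e2]; ring
    have e4 : ⟪(j : ℝ) • B (triangularVec₂ 1), B (triangularVec₁ 1)⟫_ℝ / ‖B (triangularVec₁ 1)‖ ^ 2 =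
        (j : ℝ) * ⟪B (triangularVec₁ 1), B (triangularVec₂ 1)⟫_ℝ / ‖B (triangularVec₁ 1)‖ ^ 2 := by
      rw [e1]
    rw [e3, e4]

/-- The Bessel factor of `planarLine` is elementary: for `m ≠ 0`, `c > 0`, `σ ≥ 1`,
`(π|m|/√c)^{σ−½} K_{σ−½}(2π√c|m|) = (π|m|/√c)^{σ−½} √(π/(2y)) e^{−y} halfPoly (σ−1) y`, `y = 2π√c|m|`. [this file] -/
theorem besselKReal_sub_half_eq_halfPoly (σ : ℕ) (hσ : 1 ≤ σ) {y : ℝ} (hy : 0 < y) :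
    besselKReal ((σ : ℝ) - 1 / 2) y = Real.sqrt (π / (2 * y)) * Real.exp (-y) * halfPoly (σ - 1) y := by
  have e : (σ : ℝ) - 1 / 2 = ((σ - 1 : ℕ) : ℝ) + 1 / 2 := by
    rw [Nat.cast_sub hσ]; push_cast; ring
  rw [e, besselKReal_half_add_eq (σ - 1) hy]

end PlanarExplicit

section WindowZero

/-- The window's OWN layer has label `0` (definitional): the `k = 0` near term of G2's `windowSixUp_le_near_add_far` /
`near_add_far_le_windowTwelveLo` is literally `layerSum B n 0 0`, the planar sum of this file (origin term `= 0⁻¹ = 0`). [this file] -/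
@[simp] theorem windowLabel_zero (w : Fin 6 → ℤ) : windowLabel w 0 = 0 := by simp [windowLabel]

/-- `layerSum_windowLabel_zero` (docstring added by the landing lane; see the module docstring). [formal bookkeeping] -/
theorem layerSum_windowLabel_zero (w : Fin 6 → ℤ) (B : E3 →ₗ[ℝ] E3) (n : ℕ) :
    layerSum B n 0 (windowLabel w 0) = layerSum B n 0 0 := by rw [windowLabel_zero]

/-- The origin carries no weight: `layerTerm B n 0 0 (0,0) = 0` for `n ≠ 0` (Lean's `0⁻¹ = 0`), so `layerSum B n 0 0` is the
planar lattice sum over `ℤ² ∖ {0}`. [this file] -/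
theorem layerTerm_zero_zero_origin (B : E3 →ₗ[ℝ] E3) {n : ℕ} (hn : n ≠ 0) : layerTerm B n 0 0 (0, 0) = 0 := by
  unfold layerTerm
  rw [map_layerVec]
  simp [layerShift, hn]

end WindowZero

end Summit.AtomisticToContinuum.Crystallization.Theorems.OverbindingBudgetAffineFarSmoothSplit

end
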